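import Summits.BirchSwinnertonDyer.BirchSwinnertonDyer.Theorems.KolyvaginRankRigidityAtTwoTransverseLagrangianAtTwo
import Summits.BirchSwinnertonDyer.BirchSwinnertonDyer.Theorems.Rank1ResidualJetConjActPlaceUnramified
import Literature.NumberTheory.EllipticCurves.PointDivisibilityProofs
import Literature.NumberTheory.GaloisRepresentations.ContinuousH1TrivialAction
import HarnessLib

/-!
# Crux V2♭θ / V2♭∞ (stmt-BirchSwinnertonDyer-27220; line `kolyvagin_depth_split`), stub S1, piece P8 (pure) —
# the ring-class transverse condition at a Kolyvagin prime is HOMOGENEOUS (a free `ℤ/p^k`-module)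

The S1 composition `primeSwapAtTwoLossy_core[_frob]` consumes its P7b binder through the width seat's
`pow_smul_localTatePairingZMod_eq_zero_of_transverse[_add]` (p629363), which asks two LOCAL facts of the
transverse condition `T = 𝒯_v ≤ H¹(K_λ, E[2^M])` at a Kolyvagin place: (iso) `T^⊥ = T` — landed at `2`
(`dualTransported_eq_of_localTransverseFamily_two`, p632205) — and **(pure)**: every `y ∈ T` killed by `2^b`
is a `2^{M−b}`-multiple INSIDE `T`. This file proves (pure) at every prime `p` and level `k ≤ M(ℓ)`:

* `TransversePure.exists_contOneCocycles_apply_eq` / `contOneCocycles_ext_of_cyclic` /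
  `exists_eq_smul_of_cyclic` (abstract): for a topological group `G` acting TRIVIALLY on `X`, a character
  `χ : G →* Q` with open fibres whose image is generated by `χ σ`, continuous crossed homomorphisms vanishing
  on `ker χ` are the `s ↦ e(χ s) • x` with `orderOf (χ σ) • x = 0` — so they are determined by their value at
  `σ`, and a cocycle whose value at `σ` is an `r`-multiple of an admissible value is an `r`-multiple of such a
  cocycle (`H¹(G/ker χ, X) = Hom(ℤ/d, X) = X[d]`, Rubin PCMI Prop. 1.9.5 (1)).
* `transverseSubgroup_ringClassField_homogeneous`: at a Kolyvagin prime `ℓ` of W. Zhang with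
  `k ≤ M(ℓ)` (so `Γ_{K_λ}` fixes `E[p^k]`, tree `galoisRep_toLocal_apply_eq_self`, and `p^k ∣ ℓ + 1`), for
  `Tr = ker(H¹(K_λ, E[p^k]) → H¹(K[ℓ]_{w'}, E[p^k]))`: `y ∈ Tr`, `p^b • y = 0 ⟹ y = p^{k−b} • y'` with
  `y' ∈ Tr` — via the ring-class character `Φ : Γ_{K_λ} ↠ G_ℓ` (cyclic of order `ℓ + 1`, kernel the image
  of `Γ_{K[ℓ]_{w'}}`; tree `exists_ringClassCharacter`), `H¹ = Hom` for the trivial action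
  (`oneCocycleClass_injective_of_trivial`) and the divisibility of `E(K̄)` (`zsmul_geomPoints_surjective_holds`).
* `iInf_transverseSubgroup_ringClassField_homogeneous`: the same for `⨅_{w' ∣ λ} Tr_{w'}` — the value of the
  GLOBAL intrinsic transverse family (`Walk.exists_globalTransverseFamily`) at `λ`.

HONEST FRAMING: helper (`--supports` 27220): the (pure) input of P7b for the ring-class transverse family;
S1 / V2♭θ / BSD are NOT proved here.
References: [cite: Rubin2011, Def. 1.9.4, Prop. 1.9.5 (1) (pp. 14–16)] [cite: MazurRubin2004, Def. 1.1.6,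
Lemma 1.2.1] [cite: Jetchev2008, §3.1.2 (p. 814), §3.2 (2)] [cite: McCallumLMS1991, §4]
[cite: SerreGaloisCohomology1997, I §2.3].
-/

set_option autoImplicit false
-- the Theorems namespace of this sub repeats the summit name by design (D-0017 nested layout)
set_option linter.dupNamespace false

noncomputable section

open scoped Classical Pointwise

namespace Summit.BirchSwinnertonDyer.BirchSwinnertonDyer.Theorems.KolyvaginLowerBoundAtTwo

open CategoryTheory ContinuousCohomology WeierstrassCurve Field Function NumberField IsDedekindDomain
open Literature.NumberTheory.EllipticCurves Literature.NumberTheory.EllipticCurves.Jetchev2008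
open Literature.NumberTheory.GaloisRepresentations Literature.NumberTheory.GaloisCohomology
open Literature.NumberTheory.GaloisRepresentations.DiscreteGaloisModule (transverseSubgroup SelmerStructure)
open Literature.NumberTheory.Automorphic _root_.TopRep
open Summit.BirchSwinnertonDyer.Rank1Residual.GaloisImage
open Summit.BirchSwinnertonDyer.Rank1Residual
open Summit.BirchSwinnertonDyer.Rank1Residual.JET.RingClassTransverse
open Summit.BirchSwinnertonDyer.Rank1Residual.JET.GlobalDuality (galoisRep_toLocal_apply_eq_self)
open scoped ContRepresentation NumberField

/-! ## §1 Abstract: crossed homomorphisms through a character with cyclic image, trivial action -/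

namespace TransversePure

section Abstract

universe u v

variable {R : Type u} [CommRing R] [TopologicalSpace R]
variable {G : Type v} [Group G] [TopologicalSpace G] [IsTopologicalGroup G]
variable {X : TopRep.{v} R G}

/-- `a • x = b • x` for `a ≡ b (mod d)` when `d • x = 0`. [folklore] -/
theorem nsmul_eq_nsmul_of_modEq {A : Type*} [AddCommMonoid A] {x : A} {d a b : ℕ} (hd : d • x = 0)
    (h : a ≡ b [MOD d]) : a • x = b • x := by
  have key : ∀ c : ℕ, c • x = (c % d) • x := fun c ↦ by
    conv_lhs => rw [← Nat.mod_add_div c d]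
    rw [add_nsmul, mul_nsmul, hd, nsmul_zero, add_zero]
  rw [key a, key b]
  exact congrArg (fun m : ℕ ↦ m • x) h

omit [IsTopologicalGroup G] in
/-- **A continuous crossed homomorphism through `χ` with prescribed value at `σ`.** For a TRIVIAL action,
a character `χ : G →* Q` with open fibres whose image is generated by `χ σ`, and `x ∈ X` with
`orderOf (χ σ) • x = 0`, the map `s ↦ e • x` (`χ s = χ σ ^ e`) is a continuous crossed homomorphism
vanishing on `ker χ` with value `x` at `σ` (`Hom(ℤ/d, X) = X[d]`). [cite: Rubin2011, Prop. 1.9.5 (1) (p. 16)] -/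
theorem exists_contOneCocycles_apply_eq {Q : Type*} [Group Q] (χ : G →* Q)
    (hχ : ∀ x₀ : G, IsOpen {x : G | χ x = χ x₀})
    (htriv : ∀ (g : G) (x : X), X.ρ g x = x)
    (σ : G) (hcyc : ∀ s : G, ∃ i : ℕ, χ s = χ σ ^ i)
    (x : X) (hx : orderOf (χ σ) • x = 0) :
    ∃ f : contOneCocycles X, (∀ h : G, χ h = 1 → f.1 h = 0) ∧ f.1 σ = x := by
  classical
  -- an exponent function on `Q`
  have hcyc' : ∀ q : Q, ∃ i : ℕ, (∃ s, χ s = q) → q = χ σ ^ i := by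
    intro q
    by_cases hq : ∃ s, χ s = q
    · obtain ⟨s, rfl⟩ := hq
      obtain ⟨i, hi⟩ := hcyc s
      exact ⟨i, fun _ ↦ hi⟩
    · exact ⟨0, fun h ↦ absurd h hq⟩
  choose e he using hcyc'
  have he' : ∀ s : G, χ s = χ σ ^ e (χ s) := fun s ↦ he (χ s) ⟨s, rfl⟩
  have hloc : IsLocallyConstant (χ : G → Q) := TransverseCupEven.isLocallyConstant_of_isOpen_fiber χ hχ
  let f₀ : C(G, X) := ⟨fun s ↦ e (χ s) • x, (hloc.comp (fun q : Q ↦ e q • x)).continuous⟩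
  have hf₀ : ∀ s, f₀ s = e (χ s) • x := fun _ ↦ rfl
  -- `e` is additive modulo `orderOf (χ σ)`
  have hmod : ∀ s t : G, e (χ (s * t)) ≡ e (χ s) + e (χ t) [MOD orderOf (χ σ)] := fun s t ↦ by
    refine pow_eq_pow_iff_modEq.mp ?_
    rw [← he', pow_add, ← he', ← he', map_mul]
  have hmem : f₀ ∈ contOneCocycles X := by
    rw [mem_contOneCocycles_iff]
    intro g h
    rw [hf₀, hf₀, hf₀, htriv, nsmul_eq_nsmul_of_modEq hx (hmod g h), add_nsmul]
  refine ⟨⟨f₀, hmem⟩, fun h hh ↦ ?_, ?_⟩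
  · change f₀ h = 0
    have h0 : e (χ h) ≡ 0 [MOD orderOf (χ σ)] :=
      pow_eq_pow_iff_modEq.mp (by rw [← he', hh, pow_zero])
    rw [hf₀, nsmul_eq_nsmul_of_modEq hx h0, zero_nsmul]
  · change f₀ σ = x
    have h1 : e (χ σ) ≡ 1 [MOD orderOf (χ σ)] :=
      pow_eq_pow_iff_modEq.mp (by rw [← he', pow_one])
    rw [hf₀, nsmul_eq_nsmul_of_modEq hx h1, one_nsmul]

omit [IsTopologicalGroup G] in
/-- **Uniqueness**: for a trivial action, two continuous crossed homomorphisms vanishing on `ker χ` (image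
of `χ` generated by `χ σ`) with the same value at `σ` are equal (`f s = i • f σ` on the fibre `χ s = χ σ ^ i`).
[cite: Rubin2011, Prop. 1.9.5 (1) (p. 16)] -/
theorem contOneCocycles_ext_of_cyclic {Q : Type*} [Group Q] (χ : G →* Q)
    (htriv : ∀ (g : G) (x : X), X.ρ g x = x) (σ : G) (hcyc : ∀ s : G, ∃ i : ℕ, χ s = χ σ ^ i)
    {f g : contOneCocycles X} (hfH : ∀ h : G, χ h = 1 → f.1 h = 0) (hgH : ∀ h : G, χ h = 1 → g.1 h = 0)
    (h : f.1 σ = g.1 σ) : f = g := by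
  apply Subtype.ext
  ext s
  obtain ⟨i, hi⟩ := hcyc s
  rw [TransverseCup.apply_eq_smul_of_fixed_of_ker χ f (fun s t ↦ htriv t _) hfH hi,
    TransverseCup.apply_eq_smul_of_fixed_of_ker χ g (fun s t ↦ htriv t _) hgH hi, h]

omit [IsTopologicalGroup G] in
/-- **Homogeneity of `H¹(G/ker χ, X)` for a trivial action**: a continuous crossed homomorphism `f`
vanishing on `ker χ` whose value at `σ` is `r • x` with `orderOf (χ σ) • x = 0` is `r • f'` for a continuous
crossed homomorphism `f'` vanishing on `ker χ` (with `f' σ = x`). [cite: Rubin2011, Prop. 1.9.5 (1) (p. 16)] -/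
theorem exists_eq_smul_of_cyclic {Q : Type*} [Group Q] (χ : G →* Q)
    (hχ : ∀ x₀ : G, IsOpen {x : G | χ x = χ x₀})
    (htriv : ∀ (g : G) (x : X), X.ρ g x = x) (σ : G) (hcyc : ∀ s : G, ∃ i : ℕ, χ s = χ σ ^ i)
    (f : contOneCocycles X) (hfH : ∀ h : G, χ h = 1 → f.1 h = 0)
    {r : R} {x : X} (hx : orderOf (χ σ) • x = 0) (hr : r • x = f.1 σ) :
    ∃ f' : contOneCocycles X, (∀ h : G, χ h = 1 → f'.1 h = 0) ∧ r • f' = f := by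
  obtain ⟨f', hf'H, hf'σ⟩ := exists_contOneCocycles_apply_eq χ hχ htriv σ hcyc x hx
  refine ⟨f', hf'H, contOneCocycles_ext_of_cyclic χ htriv σ hcyc (fun h hh ↦ ?_) hfH ?_⟩
  · rw [Submodule.coe_smul, ContinuousMap.smul_apply, hf'H h hh, smul_zero]
  · rw [Submodule.coe_smul, ContinuousMap.smul_apply, hf'σ, hr]

end Abstract

end TransversePure

/-! ## §2 The ring-class transverse condition at a Kolyvagin prime is homogeneous -/

variable (W : WeierstrassCurve ℚ) [W.IsElliptic] [W.IsGloballyMinimal] (K : Type) [Field K] [NumberField K]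

/-- **(pure) for `H¹_tr(K_λ, E[p^k])`** at a Kolyvagin prime `ℓ` of W. Zhang with `k ≤ M(ℓ)`, `v = λ ∋ ℓ`,
`w' ∣ λ` a place of `K[ℓ]`: if `y ∈ Tr = ker(H¹(K_λ, E[p^k]) → H¹(K[ℓ]_{w'}, E[p^k]))` and `p^b • y = 0` then
`y = p^{k-b} • y'` with `y' ∈ Tr` — `Tr ≅ Hom(G_ℓ, E[p^k]) ≅ E[p^k]` is a free `ℤ/p^k`-module (Rubin PCMI
Prop. 1.9.5 (1): `Γ_{K_λ}` fixes `E[p^k]`, `G_ℓ` cyclic of order `ℓ + 1`, `p^k ∣ ℓ + 1`, `E(K̄)` divisible).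
[cite: Rubin2011, Prop. 1.9.5 (1) (p. 16)] [cite: Jetchev2008, §3.1.2 (p. 814), §3.2 (2)]
[cite: McCallumLMS1991, §4] -/
theorem transverseSubgroup_ringClassField_homogeneous (hK : IsImaginaryQuadratic K)
    (hD : NumberField.discr K < -4) (ι : K →+* ℂ) [∀ j : ℕ, NumberField (ringClassField K ι j)]
    {p : ℕ} [Fact p.Prime] (k : ℕ) [NeZero (p ^ k)]
    {ℓ : ℕ} (hℓ : Zhang2014.IsKolyvaginPrime (W.conductorNorm ℤ) W K p ℓ)
    (hkℓ : k ≤ Zhang2014.kolyvaginIndex W p ℓ)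
    (v : HeightOneSpectrum (𝓞 K)) (hv : (ℓ : 𝓞 K) ∈ v.asIdeal)
    (w' : HeightOneSpectrum (𝓞 (ringClassField K ι ℓ))) [w'.asIdeal.LiesOver v.asIdeal]
    {y : galoisCohomology (GaloisRep.toLocal v ((W.baseChange K).torsionGaloisModule ((p ^ k : ℕ) : ℤ))) 1}
    (hy : y ∈ (letI := (adicCompletionOfLiesOver K (ringClassField K ι ℓ) v w').toAlgebra;
      transverseSubgroup (GaloisRep.toLocal v ((W.baseChange K).torsionGaloisModule ((p ^ k : ℕ) : ℤ)))
        (w'.adicCompletion (ringClassField K ι ℓ))))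
    {b : ℕ} (hb : ((p ^ b : ℕ) : ℤ) • y = 0) :
    ∃ y', y' ∈ (letI := (adicCompletionOfLiesOver K (ringClassField K ι ℓ) v w').toAlgebra;
      transverseSubgroup (GaloisRep.toLocal v ((W.baseChange K).torsionGaloisModule ((p ^ k : ℕ) : ℤ)))
        (w'.adicCompletion (ringClassField K ι ℓ))) ∧
      y = ((p ^ (k - b) : ℕ) : ℤ) • y' := by
  letI := (adicCompletionOfLiesOver K (ringClassField K ι ℓ) v w').toAlgebra
  have hp : p.Prime := Fact.out
  have hℓp : ℓ.Prime := hℓ.1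
  have hℓP : (Ideal.span {(ℓ : 𝓞 K)}).IsPrime := hℓ.2.2.2.2.1
  have hℓ0 : ℓ ≠ 0 := hℓp.ne_zero
  haveI := (finiteDimensional_and_isGalois_ringClassField hK ι hℓ0).1
  let ρv := GaloisRep.toLocal v ((W.baseChange K).torsionGaloisModule ((p ^ k : ℕ) : ℤ))
  -- `Γ_{K_λ}` fixes `E[p^k]` (`k ≤ M(ℓ)`)
  have htriv : ∀ (g : absoluteGaloisGroup (v.adicCompletion K)) (x : ρv.toTopRep), ρv.toTopRep.ρ g x = x :=
    fun g x ↦ galoisRep_toLocal_apply_eq_self W K hK hℓ hkℓ v hv g x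
  -- the ring-class character `Φ : Γ_{K_λ} ↠ G_ℓ`
  let e₀ : ringClassField K ι ℓ →ₐ[K] AlgebraicClosure K := IsAlgClosed.lift
  obtain ⟨Φ, hker, -, hsurj, hcycG, hcard⟩ := exists_ringClassCharacter K hK hD ι hℓp hℓP v hv e₀
  haveI := hcycG
  haveI : Finite (ringClassGalOver ι ℓ 1) := Nat.finite_of_card_ne_zero (by rw [hcard]; exact Nat.succ_ne_zero ℓ)
  obtain ⟨g₀, hg₀⟩ := IsCyclic.exists_monoid_generator (α := ringClassGalOver ι ℓ 1)
  obtain ⟨σ, hσ⟩ := hsurj g₀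
  have htop : Subgroup.zpowers g₀ = ⊤ := by
    rw [eq_top_iff]
    exact fun x _ ↦ mem_powers_iff_mem_zpowers.mp (hg₀ x)
  have hord : orderOf (Φ σ) = ℓ + 1 := by
    rw [hσ, ← Nat.card_zpowers, htop, Subgroup.card_top, hcard]
  have hcyc : ∀ s, ∃ i : ℕ, Φ s = Φ σ ^ i := fun s ↦ by
    obtain ⟨i, hi⟩ := (Submonoid.mem_powers_iff _ _).mp (hg₀ (Φ s))
    exact ⟨i, by rw [hσ, hi]⟩
  -- the fibres of `Φ` are open: `ker Φ` is closed of finite index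
  have hHset : ((Φ.ker : Subgroup _) : Set (absoluteGaloisGroup (v.adicCompletion K))) =
      Set.range (absGaloisRestrict (v.adicCompletion K) (w'.adicCompletion (ringClassField K ι ℓ))) := by
    ext d
    rw [SetLike.mem_coe, MonoidHom.mem_ker]
    exact ringClassCharacter_eq_one_iff_mem_range K hK ι hℓ0 v e₀ Φ hker w' d
  haveI : CharZero (w'.adicCompletion (ringClassField K ι ℓ)) := charZero_adicCompletion w'
  have hclosed : IsClosed ((Φ.ker : Subgroup _) : Set (absoluteGaloisGroup (v.adicCompletion K))) := by
    rw [hHset]; exact isClosed_range_absGaloisRestrict _ _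
  haveI : Finite (absoluteGaloisGroup (v.adicCompletion K) ⧸ Φ.ker) :=
    Finite.of_equiv _ (QuotientGroup.quotientKerEquivOfSurjective Φ hsurj).toEquiv.symm
  haveI : Φ.ker.FiniteIndex := Subgroup.finiteIndex_of_finite_quotient
  have hopen : IsOpen ((Φ.ker : Subgroup _) : Set (absoluteGaloisGroup (v.adicCompletion K))) :=
    Subgroup.isOpen_of_isClosed_of_finiteIndex Φ.ker hclosed
  have hχ : ∀ x₀, IsOpen {x : absoluteGaloisGroup (v.adicCompletion K) | Φ x = Φ x₀} := by
    intro x₀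
    have hset : {x : absoluteGaloisGroup (v.adicCompletion K) | Φ x = Φ x₀} =
        (fun x ↦ x₀⁻¹ * x) ⁻¹' ((Φ.ker : Subgroup _) : Set (absoluteGaloisGroup (v.adicCompletion K))) := by
      ext x
      simp only [Set.mem_setOf_eq, Set.mem_preimage, SetLike.mem_coe, MonoidHom.mem_ker, map_mul, map_inv,
        inv_mul_eq_one]
      exact eq_comm
    rw [hset]
    exact hopen.preimage (continuous_const.mul continuous_id)
  -- membership in `Tr` = vanishing on `ker Φ`
  have hmemTr : ∀ φ : contOneCocycles ρv.toTopRep,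
      oneCocycleClass ρv.toTopRep φ ∈ transverseSubgroup ρv (w'.adicCompletion (ringClassField K ι ℓ)) ↔
        ∀ h, Φ h = 1 → φ.1 h = 0 := by
    intro φ
    rw [mem_transverseSubgroup_iff_exists_forall_range ρv _ φ]
    constructor
    · rintro ⟨x, hx⟩ h hh
      rw [hx h ((ringClassCharacter_eq_one_iff_mem_range K hK ι hℓ0 v e₀ Φ hker w' h).1 hh)]
      change ρv.toTopRep.ρ h x - x = 0
      rw [htriv, sub_self]
    · intro H
      refine ⟨0, fun h hh ↦ ?_⟩
      rw [map_zero, sub_zero]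
      exact H h ((ringClassCharacter_eq_one_iff_mem_range K hK ι hℓ0 v e₀ Φ hker w' h).2 hh)
  -- classes of multiples (module scalar vs. `ℕ`-multiple)
  have hcl : ∀ (n : ℕ) (φ : contOneCocycles ρv.toTopRep),
      oneCocycleClass ρv.toTopRep (((n : ℕ) : ℤ) • φ) = n • oneCocycleClass ρv.toTopRep φ := fun n φ ↦ by
    have h := oneCocycleClass_smul ρv.toTopRep ((n : ℕ) : ℤ) φ
    conv at h => rhs; rw [Nat.cast_smul_eq_nsmul]
    exact h
  -- represent `y` by a crossed homomorphism `f` vanishing on `ker Φ`; `p^b • f = 0`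
  obtain ⟨f, hf⟩ := oneCocycleClass_surjective ρv.toTopRep y
  have hy' : oneCocycleClass ρv.toTopRep f ∈ transverseSubgroup ρv (w'.adicCompletion (ringClassField K ι ℓ)) := by
    rw [hf]; exact hy
  have hb' : (p ^ b) • oneCocycleClass ρv.toTopRep f = 0 := by
    rw [hf, ← natCast_zsmul]; exact hb
  have hfH : ∀ h, Φ h = 1 → f.1 h = 0 := (hmemTr f).1 hy'
  have hinj := oneCocycleClass_injective_of_trivial ρv.toTopRep htriv
  have hbf : ((p ^ b : ℕ) : ℤ) • f = 0 :=
    hinj (by rw [hcl, hb', oneCocycleClass_zero])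
  have hbσ : ((p ^ b : ℕ) : ℤ) • f.1 σ = 0 := by
    have h1 := congrArg (fun φ : contOneCocycles ρv.toTopRep ↦ φ.1 σ) hbf
    simpa only [Submodule.coe_smul, ContinuousMap.smul_apply, Submodule.coe_zero,
      ContinuousMap.zero_apply] using h1
  -- divisibility in `E[p^k]`: `f σ = p^{k-b} • x`
  obtain ⟨x, hx⟩ : ∃ x : geomTorsion (W.baseChange K) ((p ^ k : ℕ) : ℤ),
      ((p ^ (k - b) : ℕ) : ℤ) • x = f.1 σ := by
    rcases Nat.lt_or_ge b k with hbk | hkb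
    swap
    · exact ⟨f.1 σ, by rw [Nat.sub_eq_zero_of_le hkb, pow_zero, Nat.cast_one, one_smul]⟩
    · have hne : ((p ^ (k - b) : ℕ) : ℤ) ≠ 0 := by exact_mod_cast pow_ne_zero _ hp.ne_zero
      obtain ⟨Q, hQ⟩ := (W.baseChange K).zsmul_geomPoints_surjective_holds hne
        ((f.1 σ : geomTorsion (W.baseChange K) ((p ^ k : ℕ) : ℤ)) : geomPoints (W.baseChange K))
      have hQ' : (p ^ (k - b)) • Q =
          ((f.1 σ : geomTorsion (W.baseChange K) ((p ^ k : ℕ) : ℤ)) : geomPoints (W.baseChange K)) := by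
        rw [← natCast_zsmul]; exact hQ
      have hbσ' : (p ^ b) • f.1 σ = 0 := by
        rw [natCast_zsmul] at hbσ; exact hbσ
      have h2 : (p ^ b) • ((f.1 σ : geomTorsion (W.baseChange K) ((p ^ k : ℕ) : ℤ)) :
          geomPoints (W.baseChange K)) = 0 := by
        rw [← AddSubmonoidClass.coe_nsmul, hbσ', AddSubgroup.coe_zero]
      have hQmem : Q ∈ geomTorsion (W.baseChange K) ((p ^ k : ℕ) : ℤ) := by
        rw [AddSubgroup.torsionBy.nsmul_iff, show p ^ k = p ^ (k - b) * p ^ b by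
          rw [← pow_add, Nat.sub_add_cancel hbk.le], mul_nsmul, hQ', h2]
      refine ⟨⟨Q, hQmem⟩, Subtype.ext ?_⟩
      rw [AddSubgroupClass.coe_zsmul]
      exact hQ
  -- `(ℓ + 1) • x = 0` (`p^k ∣ ℓ + 1`)
  have hx0 : orderOf (Φ σ) • x = 0 := by
    rw [hord]
    obtain ⟨m, hm⟩ := (Zhang2014.le_kolyvaginIndex_iff.mp hkℓ).1
    have hpk : (p ^ k) • x = 0 := AddSubgroup.torsionBy.nsmul x
    rw [hm, mul_nsmul, hpk, nsmul_zero]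
  -- the homogeneous structure of `Hom(G_ℓ, E[p^k])`
  obtain ⟨f', hf'H, hf'eq⟩ := TransversePure.exists_eq_smul_of_cyclic Φ hχ htriv σ hcyc f hfH hx0 hx
  refine ⟨oneCocycleClass ρv.toTopRep f', (hmemTr f').2 hf'H, ?_⟩
  have h := hcl (p ^ (k - b)) f'
  rw [hf'eq, hf] at h
  rw [natCast_zsmul]
  exact h

/-- **(pure) for `⨅_{w' ∣ λ} Tr_{w'}`** — the value at `λ` of the GLOBAL intrinsic transverse family
(`Walk.exists_globalTransverseFamily`, `Walk.globalTransverse_eq_of_natCast_mem`): the transverse subgroup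
does not depend on the place `w' ∣ λ` of the Galois extension `K[ℓ]/K`
(`transverseSubgroup_adicCompletion_eq_of_liesOver`). [cite: Rubin2011, Prop. 1.9.5 (1) (p. 16)]
[cite: Jetchev2008, §3.1.2 (p. 814)] -/
theorem iInf_transverseSubgroup_ringClassField_homogeneous (hK : IsImaginaryQuadratic K)
    (hD : NumberField.discr K < -4) (ι : K →+* ℂ) [∀ j : ℕ, NumberField (ringClassField K ι j)]
    {p : ℕ} [Fact p.Prime] (k : ℕ) [NeZero (p ^ k)]
    {ℓ : ℕ} (hℓ : Zhang2014.IsKolyvaginPrime (W.conductorNorm ℤ) W K p ℓ)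
    (hkℓ : k ≤ Zhang2014.kolyvaginIndex W p ℓ)
    (v : HeightOneSpectrum (𝓞 K)) (hv : (ℓ : 𝓞 K) ∈ v.asIdeal)
    {y : galoisCohomology (GaloisRep.toLocal v ((W.baseChange K).torsionGaloisModule ((p ^ k : ℕ) : ℤ))) 1}
    (hy : y ∈ ⨅ (w' : HeightOneSpectrum (𝓞 (ringClassField K ι ℓ))) (_ : w'.asIdeal.LiesOver v.asIdeal),
      letI := (adicCompletionOfLiesOver K (ringClassField K ι ℓ) v w').toAlgebra
      transverseSubgroup (GaloisRep.toLocal v ((W.baseChange K).torsionGaloisModule ((p ^ k : ℕ) : ℤ)))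
        (w'.adicCompletion (ringClassField K ι ℓ)))
    {b : ℕ} (hb : ((p ^ b : ℕ) : ℤ) • y = 0) :
    ∃ y', (y' ∈ ⨅ (w' : HeightOneSpectrum (𝓞 (ringClassField K ι ℓ))) (_ : w'.asIdeal.LiesOver v.asIdeal),
      letI := (adicCompletionOfLiesOver K (ringClassField K ι ℓ) v w').toAlgebra
      transverseSubgroup (GaloisRep.toLocal v ((W.baseChange K).torsionGaloisModule ((p ^ k : ℕ) : ℤ)))
        (w'.adicCompletion (ringClassField K ι ℓ))) ∧
      y = ((p ^ (k - b) : ℕ) : ℤ) • y' := by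
  have hℓ0 : ℓ ≠ 0 := hℓ.1.ne_zero
  -- a place `w₀ ∣ v` of `K[ℓ]`
  haveI := (finiteDimensional_and_isGalois_ringClassField hK ι hℓ0).2
  obtain ⟨w₀⟩ := (inferInstance : Nonempty (SemiLocal.Place K (ringClassField K ι ℓ) v))
  haveI hw₀ : (w₀ : HeightOneSpectrum (𝓞 (ringClassField K ι ℓ))).asIdeal.LiesOver v.asIdeal :=
    SemiLocal.Place.liesOver w₀
  letI := (adicCompletionOfLiesOver K (ringClassField K ι ℓ) v
    (w₀ : HeightOneSpectrum (𝓞 (ringClassField K ι ℓ)))).toAlgebra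
  have heq : (⨅ (w' : HeightOneSpectrum (𝓞 (ringClassField K ι ℓ))) (_ : w'.asIdeal.LiesOver v.asIdeal),
      letI := (adicCompletionOfLiesOver K (ringClassField K ι ℓ) v w').toAlgebra
      transverseSubgroup (GaloisRep.toLocal v ((W.baseChange K).torsionGaloisModule ((p ^ k : ℕ) : ℤ)))
        (w'.adicCompletion (ringClassField K ι ℓ))) =
      transverseSubgroup (GaloisRep.toLocal v ((W.baseChange K).torsionGaloisModule ((p ^ k : ℕ) : ℤ)))
        ((w₀ : HeightOneSpectrum (𝓞 (ringClassField K ι ℓ))).adicCompletion (ringClassField K ι ℓ)) := by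
    ext z
    simp only [AddSubgroup.mem_iInf]
    constructor
    · intro H
      exact H (w₀ : HeightOneSpectrum (𝓞 (ringClassField K ι ℓ))) hw₀
    · intro hz w' hw'
      rw [transverseSubgroup_adicCompletion_eq_of_liesOver
        ((W.baseChange K).torsionGaloisModule ((p ^ k : ℕ) : ℤ)) (ringClassField K ι ℓ) v w'
        (w₀ : HeightOneSpectrum (𝓞 (ringClassField K ι ℓ)))]
      exact hz
  rw [heq] at hy ⊢
  exact transverseSubgroup_ringClassField_homogeneous W K hK hD ι k hℓ hkℓ v hv
    (w₀ : HeightOneSpectrum (𝓞 (ringClassField K ι ℓ))) hy hb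

end Summit.BirchSwinnertonDyer.BirchSwinnertonDyer.Theorems.KolyvaginLowerBoundAtTwo

end
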